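import Summits.QuantumFields.QCD.Theorems.SpectralDefectExtinctionTipPricingStubImsColdBoxes

/-!
# Helper `stub_coldBoxKatoFloor` for stub `stub_coldBoxTail` of line `covariant-laplacian-floor`
(crux `Summit.QuantumFields.QCD.Theses.SpectralDefectExtinction.TipPricing`, item stmt-QuantumFields-8967)

**Deterministic small-box exclusion (Kato floor).**  On the torus `(ℤ/(2S+1))⁴`, for EVERY `SU(3)` link
field `U`, every centre `c ∈ ℤ⁴`, every radius `R` with `R + 1 ≤ S` (a PROPER sub-box) and every colour
vector field `v` supported in `torusBox (2S+1) c R`: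

  `4/(2R+1)² · ‖v‖² ≤ Re⟨v, Lap_U v⟩`,  `Lap_U = Σ_μ (2 − F_μ − F_μᴴ)`, `F_μ = linkHop`.

Consequently a box of radius `R` is never `E'`-cold when `E' < 4/(2R+1)²`, whatever the gauge field
(`coldBox_filter_eq_empty`): the cold-box count of `stub_coldBoxTail` vanishes identically in the regime
`(2R+1)² E' < 4`, and the genuinely probabilistic content of that stub is the complementary regime
`4β ≤ (2R+1)²`, `R ≤ β` (boxes of radius `≳ √β`).

**Proof.**
1. *Link form* (`kato_re_form_lap_eq_linkSum`): `Re⟨v, Lap_U v⟩ = Σ_μ Σ_{x,a} |(F_μ v)(x,a) − v(x,a)|²`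
   (each `F_μ` is an isometry, `conjTranspose_mul_linkHop`).
2. *Kato's inequality, sitewise* (`kato_site`): with the colour modulus `|v|(x) = √(Σ_a |v(x,a)|²)`,
   `(|v|(x+μ̂) − |v|(x))² ≤ Σ_a |(F_μ v)(x,a) − v(x,a)|²` — the link matrix is unitary on `ℂ³`, then the
   squared reverse triangle inequality (adapted from the landed `stub_diamagnetic`, which carries a spin index).
3. *A discrete Poincaré inequality on the torus with a dead hyperplane* (`kato_poincare_torus`): if a real
   `g` on `(ℤ/L)⁴` is supported on the sites whose `μ`-th coordinate lies in `{a+1, …, a+M}` with `M < L`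
   (so `g = 0` on the hyperplane `{x_μ = a}`), then telescoping from the dead hyperplane and Cauchy–Schwarz
   give `g(x)² ≤ M Σ_{j<M} d(x − (j+1)μ̂)²`, `d(y) = g(y+μ̂) − g(y)`, and summing over `x` (translation
   invariance of `Σ_x`) `Σ g² ≤ M² Σ d²`.
4. The support `torusBox (2S+1) c R` has `μ`-th coordinates `c_μ − R, …, c_μ + R`, i.e. `a = c_μ − R − 1`,
   `M = 2R + 1 < 2S + 1` (`kato_torusBox_coord`); summing the four directions gives the factor `4`.

The sharp one-dimensional constant would be `2(1 − cos(π/(2R+2)))` per direction; any explicit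
`≍ 1/R²` floor serves the line.  Mathlib only; tree facts `linkHop`, `conjTranspose_mul_linkHop`,
`fundamentalRep_mem_unitaryGroup`, `torusBox`, `box`, `Torus.proj`, and the landed IMS identities
`ims_re_form_lap`, `ims_linkHop_mulVec`.
-/

namespace Summit.QuantumFields.QCD.Cruxes.TipPricing.CovariantLaplacianFloor

open MeasureTheory Filter Matrix
open Literature.MathematicalPhysics.QuantumLattice Literature.MathematicalPhysics.QuantumFieldTheory
  Literature.Probability.LatticeModels
open Summit.QuantumFields.QCD.Theses.SpectralDefectExtinction
open scoped Classical

noncomputable section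

/-! ## Generic inequalities -/

/-- Squared reverse triangle inequality in `ℓ²(ι, ℂ)`:
`(√(Σ‖f i‖²) − √(Σ‖g i‖²))² ≤ Σ ‖f i − g i‖²`. -/
-- adapted from Theorems/SpectralDefectExtinctionTipNoBindingStubDiamagnetic.lean (private there)
theorem kato_sqrt_sub_sqrt_sq_le {ι : Type*} [Fintype ι] (f g : ι → ℂ) :
    (Real.sqrt (∑ i, ‖f i‖ ^ 2) - Real.sqrt (∑ i, ‖g i‖ ^ 2)) ^ 2 ≤ ∑ i, ‖f i - g i‖ ^ 2 := by
  have hA : 0 ≤ ∑ i, ‖f i‖ ^ 2 := Finset.sum_nonneg fun _ _ => by positivity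
  have hB : 0 ≤ ∑ i, ‖g i‖ ^ 2 := Finset.sum_nonneg fun _ _ => by positivity
  have hCS : ∑ i, ‖f i‖ * ‖g i‖ ≤ Real.sqrt (∑ i, ‖f i‖ ^ 2) * Real.sqrt (∑ i, ‖g i‖ ^ 2) :=
    Real.sum_mul_le_sqrt_mul_sqrt _ _ _
  have hpt : ∀ i, ‖f i‖ ^ 2 + ‖g i‖ ^ 2 - 2 * (‖f i‖ * ‖g i‖) ≤ ‖f i - g i‖ ^ 2 := by
    intro i
    have h2 : (‖f i‖ - ‖g i‖) ^ 2 ≤ ‖f i - g i‖ ^ 2 := by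
      rw [← sq_abs (‖f i‖ - ‖g i‖)]
      exact pow_le_pow_left₀ (abs_nonneg _) (abs_norm_sub_norm_le (f i) (g i)) 2
    calc ‖f i‖ ^ 2 + ‖g i‖ ^ 2 - 2 * (‖f i‖ * ‖g i‖) = (‖f i‖ - ‖g i‖) ^ 2 := by ring
      _ ≤ ‖f i - g i‖ ^ 2 := h2
  have hsum : ∑ i, ‖f i‖ ^ 2 + ∑ i, ‖g i‖ ^ 2 - 2 * ∑ i, ‖f i‖ * ‖g i‖ ≤
      ∑ i, ‖f i - g i‖ ^ 2 := by
    have h := Finset.sum_le_sum fun i (_ : i ∈ Finset.univ) => hpt i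
    rw [Finset.sum_sub_distrib, Finset.sum_add_distrib, ← Finset.mul_sum] at h
    exact h
  rw [sub_sq, Real.sq_sqrt hA, Real.sq_sqrt hB]
  linarith only [hCS, hsum]

/-- `Σ_i ‖a i − b i‖² = Σ‖a i‖² + Σ‖b i‖² − 2 Re⟨b, a⟩` for complex vectors. -/
theorem kato_sum_norm_sub_sq {ι : Type*} [Fintype ι] (a b : ι → ℂ) :
    ∑ i, ‖a i - b i‖ ^ 2 = ∑ i, ‖a i‖ ^ 2 + ∑ i, ‖b i‖ ^ 2 - 2 * (star b ⬝ᵥ a).re := by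
  have hpt : ∀ i, ‖a i - b i‖ ^ 2 = ‖a i‖ ^ 2 + ‖b i‖ ^ 2 - 2 * (star (b i) * a i).re := by
    intro i
    rw [← Complex.normSq_eq_norm_sq, ← Complex.normSq_eq_norm_sq, ← Complex.normSq_eq_norm_sq,
      Complex.normSq_sub, Complex.star_def, mul_comm (a i)]
  simp only [hpt, Finset.sum_sub_distrib, Finset.sum_add_distrib, ← Finset.mul_sum, dotProduct,
    Pi.star_apply, Complex.re_sum]

/-! ## A discrete Poincaré inequality on the torus with a dead hyperplane -/

/-- **Poincaré on `(ℤ/L)⁴` across a dead hyperplane.**  If `g` vanishes outside the slab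
`{x | x_μ ∈ {a+1, …, a+M}}` with `M < L`, then `Σ_x g(x)² ≤ M² Σ_x (g(x+μ̂) − g(x))²`. -/
theorem kato_poincare_torus {L : ℕ} [NeZero L] (μ : Fin 4) (a : ZMod L) {M : ℕ} (hML : M < L)
    (g : TorusSite 4 L → ℝ)
    (hsupp : ∀ x, g x ≠ 0 → ∃ k : ℕ, 1 ≤ k ∧ k ≤ M ∧ x μ = a + (k : ZMod L)) :
    ∑ x, g x ^ 2 ≤ (M : ℝ) ^ 2 * ∑ x, (g (x + Pi.single μ 1) - g x) ^ 2 := by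
  set e : TorusSite 4 L := Pi.single μ 1 with he
  set d : TorusSite 4 L → ℝ := fun y => g (y + e) - g y with hd
  -- `g` vanishes on the hyperplane `{x_μ = a}`
  have hzero : ∀ z : TorusSite 4 L, z μ = a → g z = 0 := by
    intro z hz
    by_contra hne
    obtain ⟨k, hk1, hkM, hk⟩ := hsupp z hne
    rw [hz, left_eq_add] at hk
    have hdvd : L ∣ k := (ZMod.natCast_eq_zero_iff k L).mp hk
    exact absurd (Nat.le_of_dvd (by omega) hdvd) (by omega)
  have hcoord : ∀ (x : TorusSite 4 L) (n : ℕ), (x - ((n : ℕ) : ZMod L) • e) μ = x μ - n := by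
    intro x n
    simp [he]
  -- pointwise telescoping bound
  have hpt : ∀ x, g x ^ 2 ≤ (M : ℝ) * ∑ j ∈ Finset.range M, d (x - ((j + 1 : ℕ) : ZMod L) • e) ^ 2 := by
    intro x
    by_cases hx : g x = 0
    · rw [hx]
      exact le_of_eq_of_le (by ring) (mul_nonneg (Nat.cast_nonneg M)
        (Finset.sum_nonneg fun j _ => sq_nonneg _))
    obtain ⟨k, hk1, hkM, hk⟩ := hsupp x hx
    have htel : g x = ∑ j ∈ Finset.range k, d (x - ((j + 1 : ℕ) : ZMod L) • e) := by
      have h := Finset.sum_range_sub' (fun j : ℕ => g (x - ((j : ℕ) : ZMod L) • e)) k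
      have hk0 : g (x - ((k : ℕ) : ZMod L) • e) = 0 := hzero _ (by rw [hcoord, hk, add_sub_cancel_right])
      simp only [Nat.cast_zero, zero_smul, sub_zero] at h
      rw [hk0, sub_zero] at h
      rw [← h]
      refine Finset.sum_congr rfl fun j _ => ?_
      simp only [hd]
      congr 2
      push_cast
      rw [add_smul, one_smul]
      abel
    have hle : ∑ j ∈ Finset.range k, d (x - ((j + 1 : ℕ) : ZMod L) • e) ^ 2 ≤
        ∑ j ∈ Finset.range M, d (x - ((j + 1 : ℕ) : ZMod L) • e) ^ 2 :=
      Finset.sum_le_sum_of_subset_of_nonneg (Finset.range_mono hkM) fun j _ _ => sq_nonneg _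
    calc g x ^ 2 = (∑ j ∈ Finset.range k, d (x - ((j + 1 : ℕ) : ZMod L) • e)) ^ 2 := by rw [← htel]
      _ ≤ (Finset.range k).card * ∑ j ∈ Finset.range k, d (x - ((j + 1 : ℕ) : ZMod L) • e) ^ 2 :=
          sq_sum_le_card_mul_sum_sq
      _ ≤ (M : ℝ) * ∑ j ∈ Finset.range M, d (x - ((j + 1 : ℕ) : ZMod L) • e) ^ 2 := by
          rw [Finset.card_range]
          exact mul_le_mul (by exact_mod_cast hkM) hle
            (Finset.sum_nonneg fun j _ => sq_nonneg _) (Nat.cast_nonneg M)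
  -- sum over `x`, swap, translation invariance
  calc ∑ x, g x ^ 2 ≤ ∑ x, (M : ℝ) * ∑ j ∈ Finset.range M, d (x - ((j + 1 : ℕ) : ZMod L) • e) ^ 2 :=
        Finset.sum_le_sum fun x _ => hpt x
    _ = (M : ℝ) * ∑ j ∈ Finset.range M, ∑ x, d (x - ((j + 1 : ℕ) : ZMod L) • e) ^ 2 := by
        rw [← Finset.mul_sum, Finset.sum_comm]
    _ = (M : ℝ) * ∑ j ∈ Finset.range M, ∑ y, d y ^ 2 := by
        congr 1
        refine Finset.sum_congr rfl fun j _ => ?_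
        exact Fintype.sum_equiv (Equiv.subRight _) _ _ fun x => rfl
    _ = (M : ℝ) ^ 2 * ∑ y, d y ^ 2 := by
        rw [Finset.sum_const, Finset.card_range, nsmul_eq_mul]
        ring

/-! ## Geometry of the support -/

/-- The `μ`-th coordinate of a site of `torusBox (2S+1) c R` is `c_μ − R − 1 + k` with `1 ≤ k ≤ 2R+1`. -/
theorem kato_torusBox_coord (S R : ℕ) (c : Site 4) {x : TorusSite 4 (2 * S + 1)}
    (hx : x ∈ torusBox (2 * S + 1) c R) (μ : Fin 4) :
    ∃ k : ℕ, 1 ≤ k ∧ k ≤ 2 * R + 1 ∧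
      x μ = ((c μ - R - 1 : ℤ) : ZMod (2 * S + 1)) + ((k : ℕ) : ZMod (2 * S + 1)) := by
  rw [torusBox, Finset.mem_image] at hx
  obtain ⟨y, hy, rfl⟩ := hx
  rw [mem_box] at hy
  obtain ⟨h1, h2⟩ := hy μ
  refine ⟨(y μ + R + 1).toNat, by omega, by omega, ?_⟩
  have hk : (((y μ + R + 1).toNat : ℕ) : ℤ) = y μ + R + 1 := Int.toNat_of_nonneg (by omega)
  rw [Torus.proj_apply, Pi.add_apply, ← Int.cast_natCast (R := ZMod (2 * S + 1)) (y μ + R + 1).toNat, hk]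
  push_cast
  ring

/-! ## Kato's inequality for the covariant Laplacian -/

section Kato

variable {L : ℕ} [NeZero L] (U : GaugeConfig 4 L SU3)

/-- Link form of one direction: `Σ_i |(F_μ v) i − v i|² = 2‖v‖² − 2 Re⟨v, F_μ v⟩` (`F_μ` an isometry). -/
theorem kato_linkDiff_eq (μ : Fin 4) (v : TorusSite 4 L × Fin 3 → ℂ) :
    ∑ i, ‖(linkHop (fundamentalRep (Fin 3)) U μ *ᵥ v) i - v i‖ ^ 2 =
      2 * ∑ i, ‖v i‖ ^ 2 - 2 * (star v ⬝ᵥ linkHop (fundamentalRep (Fin 3)) U μ *ᵥ v).re := by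
  rw [kato_sum_norm_sub_sq, Theorems.WindowExtinction.Negative.sum_norm_sq_mulVec_of_isometry
    (conjTranspose_mul_linkHop (fundamentalRep (Fin 3)) fundamentalRep_mem_unitaryGroup U μ)]
  ring

variable {A : Matrix (TorusSite 4 L × Fin 3) (TorusSite 4 L × Fin 3) ℂ}
  (hA : A = ∑ μ : Fin 4, ((2 : ℂ) • (1 : Matrix (TorusSite 4 L × Fin 3) (TorusSite 4 L × Fin 3) ℂ)
    - linkHop (fundamentalRep (Fin 3)) U μ - (linkHop (fundamentalRep (Fin 3)) U μ)ᴴ))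

include hA in
/-- **The covariant Dirichlet form as a link sum**: `Re⟨v, Lap_U v⟩ = Σ_μ Σ_i |(F_μ v) i − v i|²`. -/
theorem kato_re_form_lap_eq_linkSum (v : TorusSite 4 L × Fin 3 → ℂ) :
    (star v ⬝ᵥ A *ᵥ v).re = ∑ μ : Fin 4, ∑ i, ‖(linkHop (fundamentalRep (Fin 3)) U μ *ᵥ v) i - v i‖ ^ 2 := by
  rw [ims_re_form_lap U hA]
  exact Finset.sum_congr rfl fun μ _ => (kato_linkDiff_eq U μ v).symm

/-- **Kato's inequality, sitewise, colour only**: `(|v|(x+μ̂) − |v|(x))² ≤ Σ_a |(F_μ v)(x,a) − v(x,a)|²`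
with `|v|(x) = √(Σ_a |v(x,a)|²)` (the link matrix is unitary on `ℂ³`). -/
theorem kato_site (μ : Fin 4) (v : TorusSite 4 L × Fin 3 → ℂ) (x : TorusSite 4 L) :
    (Real.sqrt (∑ a, ‖v (x + Pi.single μ 1, a)‖ ^ 2) - Real.sqrt (∑ a, ‖v (x, a)‖ ^ 2)) ^ 2 ≤
      ∑ a, ‖(linkHop (fundamentalRep (Fin 3)) U μ *ᵥ v) (x, a) - v (x, a)‖ ^ 2 := by
  have hM : (fundamentalRep (Fin 3) (U (x, μ)))ᴴ * fundamentalRep (Fin 3) (U (x, μ)) = 1 :=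
    Matrix.mem_unitaryGroup_iff'.mp (fundamentalRep_mem_unitaryGroup (U (x, μ)))
  set w : Fin 3 → ℂ := fun b => v (x + Pi.single μ 1, b) with hw
  have hF : ∀ a, (linkHop (fundamentalRep (Fin 3)) U μ *ᵥ v) (x, a) =
      (fundamentalRep (Fin 3) (U (x, μ)) *ᵥ w) a := by
    intro a
    rw [ims_linkHop_mulVec]
    rfl
  have hu : ∑ a, ‖(fundamentalRep (Fin 3) (U (x, μ)) *ᵥ w) a‖ ^ 2 = ∑ a, ‖v (x + Pi.single μ 1, a)‖ ^ 2 :=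
    Theorems.WindowExtinction.Negative.sum_norm_sq_mulVec_of_isometry hM w
  simp_rw [hF]
  rw [← hu]
  exact kato_sqrt_sub_sqrt_sq_le _ _

/-- Kato summed over the torus: `Σ_x (|v|(x+μ̂) − |v|(x))² ≤ Σ_i |(F_μ v) i − v i|²`. -/
theorem kato_sum (μ : Fin 4) (v : TorusSite 4 L × Fin 3 → ℂ) :
    ∑ x : TorusSite 4 L, (Real.sqrt (∑ a, ‖v (x + Pi.single μ 1, a)‖ ^ 2) -
        Real.sqrt (∑ a, ‖v (x, a)‖ ^ 2)) ^ 2 ≤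
      ∑ i, ‖(linkHop (fundamentalRep (Fin 3)) U μ *ᵥ v) i - v i‖ ^ 2 := by
  rw [Fintype.sum_prod_type]
  exact Finset.sum_le_sum fun x _ => kato_site U μ v x

end Kato

/-! ## The Kato floor on proper sub-boxes -/

/-- **Kato floor** (helper for stub `stub_coldBoxTail` of line `covariant-laplacian-floor`).  On the torus of
odd side `2S+1`, for every `SU(3)` link field `U`, every centre `c`, every radius `R` with `R + 1 ≤ S` and
every colour vector field `v` supported in `torusBox (2S+1) c R`:
`4/(2R+1)² · Σ_i |v i|² ≤ Re⟨v, Lap_U v⟩`, `Lap_U = Σ_μ (2 − F_μ − F_μᴴ)` — Kato's diamagnetic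
inequality (`Re⟨v, Lap_U v⟩ ≥ ⟨|v|, Lap_free |v|⟩` direction by direction) and a discrete Dirichlet
Poincaré inequality across the hyperplanes `x_μ = c_μ − R − 1`, which miss the box because `R < S`. -/
theorem stub_coldBoxKatoFloor :
    ∀ (S R : ℕ), R + 1 ≤ S → ∀ (U : GaugeConfig 4 (2 * S + 1) SU3) (c : Site 4)
      (v : TorusSite 4 (2 * S + 1) × Fin 3 → ℂ),
      (∀ p : TorusSite 4 (2 * S + 1) × Fin 3, p.1 ∉ torusBox (2 * S + 1) c R → v p = 0) →
      4 / (2 * R + 1 : ℝ) ^ 2 * ∑ i, ‖v i‖ ^ 2 ≤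
        (star v ⬝ᵥ (∑ μ : Fin 4, ((2 : ℂ) • (1 : Matrix (TorusSite 4 (2 * S + 1) × Fin 3)
            (TorusSite 4 (2 * S + 1) × Fin 3) ℂ)
          - linkHop (fundamentalRep (Fin 3)) U μ
          - (linkHop (fundamentalRep (Fin 3)) U μ)ᴴ)) *ᵥ v).re := by
  intro S R hRS U c v hsupp
  set A : Matrix (TorusSite 4 (2 * S + 1) × Fin 3) (TorusSite 4 (2 * S + 1) × Fin 3) ℂ :=
    ∑ μ : Fin 4, ((2 : ℂ) • (1 : Matrix (TorusSite 4 (2 * S + 1) × Fin 3)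
      (TorusSite 4 (2 * S + 1) × Fin 3) ℂ) - linkHop (fundamentalRep (Fin 3)) U μ
      - (linkHop (fundamentalRep (Fin 3)) U μ)ᴴ) with hAdef
  rw [kato_re_form_lap_eq_linkSum U hAdef v]
  set M : ℕ := 2 * R + 1 with hM
  have hMpos : (0 : ℝ) < M := by positivity
  have hML : M < 2 * S + 1 := by omega
  -- the colour modulus
  set g : TorusSite 4 (2 * S + 1) → ℝ := fun x => Real.sqrt (∑ a, ‖v (x, a)‖ ^ 2) with hg
  have hg2 : ∀ x, g x ^ 2 = ∑ a, ‖v (x, a)‖ ^ 2 := fun x =>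
    Real.sq_sqrt (Finset.sum_nonneg fun a _ => sq_nonneg _)
  have hmass : ∑ i, ‖v i‖ ^ 2 = ∑ x, g x ^ 2 := by
    rw [Fintype.sum_prod_type]
    exact Finset.sum_congr rfl fun x _ => (hg2 x).symm
  -- one direction at a time
  have hdir : ∀ μ : Fin 4, ∑ i, ‖v i‖ ^ 2 ≤
      (M : ℝ) ^ 2 * ∑ i, ‖(linkHop (fundamentalRep (Fin 3)) U μ *ᵥ v) i - v i‖ ^ 2 := by
    intro μ
    have hsuppg : ∀ x, g x ≠ 0 → ∃ k : ℕ, 1 ≤ k ∧ k ≤ M ∧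
        x μ = ((c μ - R - 1 : ℤ) : ZMod (2 * S + 1)) + ((k : ℕ) : ZMod (2 * S + 1)) := by
      intro x hx
      have hxbox : x ∈ torusBox (2 * S + 1) c R := by
        by_contra hnot
        apply hx
        have h0 : ∀ a, v (x, a) = 0 := fun a => hsupp (x, a) hnot
        simp [hg, h0]
      exact kato_torusBox_coord S R c hxbox μ
    have hP := kato_poincare_torus μ ((c μ - R - 1 : ℤ) : ZMod (2 * S + 1)) hML g hsuppg
    calc ∑ i, ‖v i‖ ^ 2 = ∑ x, g x ^ 2 := hmass
      _ ≤ (M : ℝ) ^ 2 * ∑ x, (g (x + Pi.single μ 1) - g x) ^ 2 := hP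
      _ ≤ (M : ℝ) ^ 2 * ∑ i, ‖(linkHop (fundamentalRep (Fin 3)) U μ *ᵥ v) i - v i‖ ^ 2 :=
          mul_le_mul_of_nonneg_left (kato_sum U μ v) (sq_nonneg _)
  -- the four directions
  have h4 : 4 * ∑ i, ‖v i‖ ^ 2 ≤
      (M : ℝ) ^ 2 * ∑ μ : Fin 4, ∑ i, ‖(linkHop (fundamentalRep (Fin 3)) U μ *ᵥ v) i - v i‖ ^ 2 := by
    calc 4 * ∑ i, ‖v i‖ ^ 2 = ∑ _μ : Fin 4, ∑ i, ‖v i‖ ^ 2 := by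
          rw [Finset.sum_const, Finset.card_univ, Fintype.card_fin, nsmul_eq_mul]
          push_cast
          ring
      _ ≤ ∑ μ : Fin 4, (M : ℝ) ^ 2 * ∑ i, ‖(linkHop (fundamentalRep (Fin 3)) U μ *ᵥ v) i - v i‖ ^ 2 :=
          Finset.sum_le_sum fun μ _ => hdir μ
      _ = (M : ℝ) ^ 2 * ∑ μ : Fin 4, ∑ i, ‖(linkHop (fundamentalRep (Fin 3)) U μ *ᵥ v) i - v i‖ ^ 2 := by
          rw [Finset.mul_sum]
  have hMc : ((2 * R + 1 : ℕ) : ℝ) = (2 * R + 1 : ℝ) := by push_cast; ring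
  rw [← hMc, div_mul_eq_mul_div, div_le_iff₀ (by positivity)]
  linarith [h4]

/-- **No cold proper box below the Kato floor.**  If `E' < 4/(2R+1)²`, the set of `E'`-cold centres of
radius `R` (`R + 1 ≤ S`) is empty for EVERY gauge field: the cold-box count of `stub_coldBoxTail`
vanishes identically in this regime. -/
theorem coldBox_filter_eq_empty (S R : ℕ) (hRS : R + 1 ≤ S) (U : GaugeConfig 4 (2 * S + 1) SU3)
    (E' : ℝ) (hE' : E' < 4 / (2 * R + 1 : ℝ) ^ 2) :
    ((box 4 S).filter fun c : Site 4 =>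
      ∃ v : TorusSite 4 (2 * S + 1) × Fin 3 → ℂ, v ≠ 0 ∧
        (∀ p : TorusSite 4 (2 * S + 1) × Fin 3, p.1 ∉ torusBox (2 * S + 1) c R → v p = 0) ∧
        (star v ⬝ᵥ (∑ μ : Fin 4, ((2 : ℂ) • (1 : Matrix (TorusSite 4 (2 * S + 1) × Fin 3)
            (TorusSite 4 (2 * S + 1) × Fin 3) ℂ)
          - linkHop (fundamentalRep (Fin 3)) U μ
          - (linkHop (fundamentalRep (Fin 3)) U μ)ᴴ)) *ᵥ v).re
          ≤ E' * ∑ i, ‖v i‖ ^ 2) = ∅ := by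
  rw [Finset.filter_eq_empty_iff]
  rintro c - ⟨v, hv0, hsupp, hcold⟩
  have hfloor := stub_coldBoxKatoFloor S R hRS U c v hsupp
  have hpos : 0 < ∑ i, ‖v i‖ ^ 2 := by
    obtain ⟨i, hi⟩ : ∃ i, v i ≠ 0 := by
      by_contra hall
      push Not at hall
      exact hv0 (funext hall)
    exact lt_of_lt_of_le (by positivity : 0 < ‖v i‖ ^ 2)
      (Finset.single_le_sum (f := fun i => ‖v i‖ ^ 2) (fun i _ => sq_nonneg _) (Finset.mem_univ i))
  have hlt : E' * ∑ i, ‖v i‖ ^ 2 < 4 / (2 * R + 1 : ℝ) ^ 2 * ∑ i, ‖v i‖ ^ 2 :=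
    mul_lt_mul_of_pos_right hE' hpos
  linarith

end

end Summit.QuantumFields.QCD.Cruxes.TipPricing.CovariantLaplacianFloor
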